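import Summits.QuantumFields.YangMills.Theses.BalabanUVNodes
import Summits.QuantumFields.YangMills.Theorems.BalabanUVNodesN27AtAllPinsOfRecord13CoPHVCutBFreeBareLedgerReading
import Summits.QuantumFields.YangMills.Theorems.BalabanUVNodesN20OffLiveOneTermReading
import Summits.QuantumFields.YangMills.Theorems.BalabanUVNodesN18U3LettersOfLocalTermsPackageTermwise
import Summits.QuantumFields.YangMills.Theorems.BalabanUVNodesN18KernelStepRateKingMechanismWindowed
import Summits.QuantumFields.YangMills.Theorems.BalabanUVNodesN22WindowSoftTwoPointAtRecordReadOut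
import Summits.QuantumFields.YangMills.Theorems.BalabanUVNodesN22WindowedNE9OfCouplingHolo

/-!
# ★★★ K3⁸ LEAF AWBⱽ-1T-U3C (dag-n27-c g17, trigger (t2⁗)): THE ITEM `Theses.BalabanUVNodes.SpineGivenEndpointR13SepCoPHV` AT EVERY VERSION SLOT `v` — LEAF AWBⱽ-1T (p642511) WITH
# **ALL FIVE OF NODE U3's LETTER ROWS `hr ∕ hinc ∕ hS ∕ h9 ∕ hWall` PRODUCED** over ONE localization: per tuple `(F, θ)`, W1-20's law `hloc : Localizes17OfRecord₁₃ F 2 θ.toStage13Params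
# (S F θ) (emb F θ)` for cluster towers `S` valued in `MatA 2` read through `emb`, ONE `(κ, δ₀, r, B₃)` (`M = L^{m′}`), and
#  (i) dag-n18-w2 g10's TERM-DATA PACKAGE `YMDAG.N18.U3LettersPackage.u3LettersOfRecord₁₃_of_termwiseLocalTermData` (`…N18U3LettersOfLocalTermsPackageTermwise`, p643904; consumer
#      map INBOX l.40269): (P1) single-run analytic data `ι₁ G₁ U₁` with (4.35) tails and (1.18) sup decay, (P2′) the local domain matching `φ` + the per-term volume-independence
#      rate, (P3) the two-run holomorphic data `ιc GB GA U` with the TERM-LEVEL two-run sup bound ⟹ `hr ∕ hinc ∕ hS` (conjuncts 1 ∕ 2 ∕ 4; `s := 1`, `r := r_inc`);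
#  (ii) the n22 lane's W1-19b LETTERS OF RECORD from W1's THREE SLOTS `Bound238` ∕ `YoungLipschitz` (moduli `Λ`) ∕ PRINTED `AnalyticH` on prefix sets `Wk` ⊇ the window's cut
#      histories, Road 1's numerals `(A, R, r₁)`, complexified readings `Φ` of the record's β-chart HOLOMORPHIC on `U₉ ⊇ ball 0 r` extending `emb ∘ exp θ.ρ8` into the spaces `sp`,
#      site weights `wt` with the minimizer tails ⟹ `h9 ∕ hWall` — dag-n22-w2's `YMDAG.N22.WindowSoftTwoPoint.windowedNE9OfRecord₁₃_letterRow_of_activitySlots` ∕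
#      `windowedDecayOfRecord₁₃_letterRow_of_activitySlots` (`…N22WindowSoftTwoPointAtRecordReadOut`) with `hHhol` DISCHARGED from PRINTED `AnalyticH` by dag-n22-c's chain rule
#      `differentiableOn_H_comp_of_analyticH` (exactly dag-n22-w5 g0's `…N22AtRecordOfPrintedSlots` §1 composition, p608801; ReadOut p610496);
# all carried to the letter reading `ℓ F θ` by DOMINATION rows `hℓκ : (ℓ F θ).κ ≤ δ₁ := delta1 δ₀ κ (4M)`, `hℓθ`, `hℓC` (dag-n18-w4's `windowedStepRateOfRecord₁₃_mono`, p608767) and `hℓΛ : C₉′·Λ k i ≤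
# (ℓ F θ).moduli k i`.  Binder texts VERBATIM from p643904 :79–:137 and the ReadOut letterRow theorem under the family-indexing substitution `x ↦ x F θ` (`N := 2`, `𝔸 := MatA 2`,
# `θ := θ.toStage13Params`; n22's `Ec ι U w` renamed `E₉ ι₉ U₉ wt`; `κ δ₀ B₃ r M S emb hloc` SHARED by the two producers), content rows guarded by `Provisos₁₃CoPH → guard →
# Admissible`.  Body = p642511's VERBATIM behind the producing `have`s; storey APBᴮ (p641816), (Kꜰ)ᴮ at `crOneTerm₁₃ K₀`, FILE 1's split at `Node00.datumOfRecord₁₃SepCoPHV F 2 θ h v` BY NAME.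
# (cell `pub-ymgap`, D-0062 Track A, seat `pub-ymgap-dag-n27-c` gen 17; `--kind proof --supports stmt-QuantumFields-27366 --as helper`; COUNT-NEUTRAL; ONE theorem, 0 `def`, 0 `sorry`;
# a route-facing leaf, nothing may import it)

THE ITEM then costs: the pins · `h16` · node U3's SIGNS ∕ read-out rows `hs hκ hcr hκ₀` at `ℓ` · W1-20's law + the term data + W1's three slots + readings ∕ weights ∕ tails + the four
domination rows (NO U3 letter row `hr hinc hS h9 hWall` left) · `hβ23 hβ1 hmatch hend hradii hclass hH3 hsel3` · K1's window `hβw` · live `hζm h20 h21 hlinkBareV` · off-live `htarget`.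

HONEST FRAMING.  COMPOSITE-node bookkeeping BY NAME; NOT a discharge: a term of the item's type under displayed hypotheses (audit `proof.conditional`), every one a HYPOTHESIS inhabited for no
family today (K0⁷ `Record13SepCoPHInhabited` OPEN) or a decided MODEL behind a pin; W1-20's law (1.7), W1's slots (2.38) ∕ Young–Lipschitz ∕ analyticity ([II] p. 15), the analytic term
representations (NODE A ∕ N10), the matching (geometry), the per-term volume rate and the TERM-LEVEL TWO-RUN SUP BOUND (node N18, NOT PRINTED for d = 4) are DISPLAYED, asserted for no
family; nothing of (1.6) ∕ (2.13) constructed; `hlinkBareV` = NODE O's world (UNPRINTED for d = 4, 0 instances); N11 NOT READ; `htarget` and every rate HYPOTHESES; `hβw` = K1's window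
(K1⁹ OPEN); `hradii ∧ hclass`, `hH3`∕`hsel3` = THE END's ∕ node N16's content; `hκ₀` a SHAPE; NE7b ∕ NE7c witnesses 0∕1; all letters and data FREE (no reading minted); nothing of
Bałaban's or King's asserted or instantiated; NOT `stub_rates13HV` ∕ `stub_expansion13HV`; N14–N22 ∕ N27 NOT discharged; K3⁸ OPEN, NOT claimed; skeleton v6 untouched; counts UNMOVED
(typed 28∕28 · discharged 5∕27, A 5∕28); R4 is the CONDITIONAL finite-𝕋⁴ rung `BalabanLadder.UV` only: NOT ℝ⁴, NOT infinite volume, NOT OS, NOT a mass gap, NOT Clay.  No decl below carries a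
cite tag (the producers' TYPES cite [Balaban1987RG1], [Balaban1988RG2Cluster], [King1986] — there, not here).
-/

set_option autoImplicit false

namespace Summit.QuantumFields.YangMills.Theorems.BalabanUVNodesN27SpineRecord
open scoped BigOperators Matrix Matrix.Norms.L2Operator
open Finset MeasureTheory
open Literature.MathematicalPhysics.QuantumFieldTheory.Balaban1983to89
open T4OutputRate T4RecentScale T4GoodClassBudget T4CauchySum T4TowerRateComposition T4TowerRateDischarge
open T4EtaRateMin (Readings NE3Shape)
open T4RateLiaison (GaugeDominated)
open FlowStep (RGEqH prefixOf Box)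
open TreeLengthTorus (TFaceConnected torusTreeLen TPt)
open B12TreeDecay (kappa₀)
open Summit.QuantumFields.BalabanUV.T4Continuum
open AveragingDeficitDualResidual (dualC1 dualC2)
open AveragingDeficitDerivWallProof (wallConst)
open AveragingDeficitPeriodicCounting (IsPeriodicDir)
open MinimalActionSandwich (IsMinimiser minAct)
open MinimalActionRate (sfClass)
open MinimalActionRefine (RegularSup gradConst)
open NE3EnergyShapes (IsUnitarySite IsPeriodicSite)
open NE3.LeafIndexSockets (LeafH3sup)
open Summit.QuantumFields.BalabanUV.T4Continuum.Spine
open Summit.QuantumFields.BalabanUV.T4Continuum.Spine.NE4 (runFlow)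
open Summit.QuantumFields.BalabanUV.T4Continuum.NE1p.DressedRoot (DressedTower DressedStabilityStrict)
open Summit.QuantumFields.YangMills.BalabanUVNodes.N19LedgerLinkSync (LedgerDataSync LedgerAtSync)
open YMDAG.UVSplit
open Summit.QuantumFields.YangMills.BalabanUVNodes.N16HolderDefs (CovRootHolder N16HolderAt)
open Summit.QuantumFields.YangMills.BalabanUVNodes.SpineRatesHolder (RatesHolderAt)
open Literature.MathematicalPhysics.QuantumFieldTheory.Balaban1983to89.T4Continuum (T4Family ULoop)
open Node00 (Stage13HParams datumOfRecord₁₃CoPH SiteSeqKey U3Letters₁₁ NE3Letters₁₁ ne3ConstLayerOfRecord₁₁ ne3NperOfRecord₁₁ ne3DomOfRecord₁₁ ZetaMeasurable ppSelLiveOfRecord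
  EOfRecord₁₃ wOfRecord₉ localBgMeasurable MatA polScalar siteOfInt)
open Literature.MathematicalPhysics.QuantumFieldTheory.Balaban1983to89.B12Sec2to5 (betaPrime510)
open Literature.MathematicalPhysics.QuantumFieldTheory.Balaban1983to89.Node00.U3OfKernels (objectsOfRecord₁₃ KernelDecayOfRecord₁₃ histPrefix)
open Literature.MathematicalPhysics.QuantumFieldTheory.Balaban1983to89.Node00.U3KernelLetters (GeometricIncrementsOfRecord₁₃ WindowedNE9OfRecord₁₃ WindowedDecayOfRecord₁₃
  WindowedStepRateOfRecord₁₃)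
open Summit.QuantumFields.YangMills.BalabanUVNodes.N16PinnedLayer13CoPH (N16PinnedLoose N16LettersEnd rateCarriers_ne3_of_pinnedLoose)
open Summit.QuantumFields.YangMills.BalabanUVNodes.N19TargetClassWeightsE1Keyed
open YMDAG.N14.TopBorn (Ne1PinnedOfRecord n14At_rateCarriersOfRecord₁₃CoPH_of_pinned)
open Summit.QuantumFields.YangMills.BalabanUVNodes.N15.GenuineRecord (fullGSizedObjects n15At_fullGSizedObjects_family)
open Summit.QuantumFields.YangMills.BalabanUVNodes.N15.AtKeyedHome (neZero_blockFactor)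
open YMDAG.N18.PolLimitRate (u3KernelInputs_of_finiteVolumeLetters)
open Literature.MathematicalPhysics.QuantumFieldTheory.Balaban1983to89.Node00.LocalizedSum17 (ReadingMaps Localizes17OfRecord₁₃) open Literature.MathematicalPhysics.QuantumFieldTheory.Balaban1983to89.Node00.Sect2 (domSys domCount CPair)
open Literature.MathematicalPhysics.QuantumFieldTheory.Balaban1983to89.Node00.W1 (ClusterTower castDom domSys_succ) open Literature.MathematicalPhysics.QuantumFieldTheory.Balaban1983to89.T4LevelShift (siteShift)
open Literature.MathematicalPhysics.QuantumFieldTheory.Balaban1983to89.B12PolarizationTensor120 (expChart) open Literature.MathematicalPhysics.QuantumFieldTheory.Balaban1983to89.B12Decay510 (delta1)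
open Literature.MathematicalPhysics.QuantumFieldTheory.Balaban1983to89.B12Decay510Window (K₁) open Literature.MathematicalPhysics.QuantumFieldTheory.Balaban1983to89.B12Decay510Torus (distCT nearT)
open YMDAG.N18.TwoRunWindowLevelShift (ladder)
open YMDAG.N18.U3LettersPackage (u3LettersOfRecord₁₃_of_termwiseLocalTermData)
open YMDAG.N18.KernelStepRateKingMechanism (windowedStepRateOfRecord₁₃_mono)
open YMDAG.N22.WindowSoftTwoPoint (windowedNE9OfRecord₁₃_letterRow_of_activitySlots windowedDecayOfRecord₁₃_letterRow_of_activitySlots)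
open YMDAG.N22.WindowedOfCouplingHolo (differentiableOn_H_comp_of_analyticH)
open T4WeightBudget T4IndicatorShell T4ContinuumYM4Torus T4ApexHybrid
open Summit.QuantumFields.YangMills.Theses.BalabanUVNodes (SpineGivenEndpointR13SepCoPHV)
open NE7 (Target)
open Summit.QuantumFields.YangMills.BalabanUVNodes.N20OffLiveOneTermReading (crOneTerm₁₃ h20_shape_crOneTerm₁₃ h21_shape_crOneTerm₁₃ extraction_crOneTerm₁₃ core_crOneTerm₁₃_iff_target)
variable (K₀ : ℕ) (jc : (F : T4Family) → (θ : Stage13HParams F 2) → θ.Provisos₁₃CoPH F 2 → (ℕ → ℝ) → List (ULoop F) → ℕ → ℕ)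
  (sh : ShellSplit₁₃CoPH 2 K₀)
  (β : ℝ) (𝔯 : RateReading₁₃CoPH 2)
  (ℓ : (F : T4Family) → Stage13HParams F 2 → U3Letters₁₁)
  (ℓ₃ : T4Family → NE3Letters₁₁) (g B c' : T4Family → ℝ)
variable (Ec : (F : T4Family) → Stage13HParams F 2 → Type*)
  [∀ (F : T4Family) (θ : Stage13HParams F 2), NormedAddCommGroup (Ec F θ)] [∀ (F : T4Family) (θ : Stage13HParams F 2), NormedSpace ℂ (Ec F θ)]
  (m' M : (F : T4Family) → Stage13HParams F 2 → ℕ) [hM0 : ∀ (F : T4Family) (θ : Stage13HParams F 2), NeZero (M F θ)]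
  (S : (F : T4Family) → (θ : Stage13HParams F 2) → (K : ℕ) → ClusterTower (F.P K) (MatA 2) (M F θ))
  (emb : (F : T4Family) → (θ : Stage13HParams F 2) → ReadingMaps F (MatA 2) (MatA 2)) (κ δ₀ ω cρ r E₀ B₃ θ₅ M₀ : (F : T4Family) → Stage13HParams F 2 → ℝ)
  (ι₁ : (F : T4Family) → (θ : Stage13HParams F 2) →
      (letI := θ.instVβ₁; letI := θ.instVβ₂;
      (g : ℕ → ℝ) → (k K : ℕ) → (domSys (F.P K) (M F θ) (k + 1)).Dom → ((Fin (F.P K).d → Site (F.P K) (k + 1) → θ.Vβ) →L[ℝ] (Ec F θ))))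
  (G₁ : (F : T4Family) → (θ : Stage13HParams F 2) → (g : ℕ → ℝ) → (k K : ℕ) → (domSys (F.P K) (M F θ) (k + 1)).Dom → (Ec F θ) → ℂ)
  (U₁ : (F : T4Family) → (θ : Stage13HParams F 2) → (g : ℕ → ℝ) → (k K : ℕ) → (domSys (F.P K) (M F θ) (k + 1)).Dom → Set (Ec F θ))
  (φ : (F : T4Family) → (θ : Stage13HParams F 2) → (k K : ℕ) → (domSys (F.P K) (M F θ) (k + 1)).Dom → (domSys (F.P (K + 1)) (M F θ) (k + 1)).Dom)
  (ιc : (F : T4Family) → (θ : Stage13HParams F 2) →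
      (letI := θ.instVβ₁; letI := θ.instVβ₂;
      (k : ℕ) → (Fin (k + 2) → ℝ) → (K : ℕ) → (domSys (F.P (K + 1)) (M F θ) (k + 1 + 1)).Dom → ((Fin (F.P (K + 1)).d → Site (F.P (K + 1)) (k + 1 + 1) → θ.Vβ) →L[ℝ] (Ec F θ))))
  (GB : (F : T4Family) → (θ : Stage13HParams F 2) → (k : ℕ) → (Fin (k + 2) → ℝ) → (K : ℕ) → (domSys (F.P (K + 1)) (M F θ) (k + 1 + 1)).Dom → (Ec F θ) → ℂ)
  (GA : (F : T4Family) → (θ : Stage13HParams F 2) → (k : ℕ) → (Fin (k + 2) → ℝ) → (K : ℕ) → (domSys (F.P (K + 1)) (M F θ) (k + 1 + 1)).Dom → (Ec F θ) → ℂ)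
  (U : (F : T4Family) → (θ : Stage13HParams F 2) → (k : ℕ) → (Fin (k + 2) → ℝ) → (K : ℕ) → (domSys (F.P (K + 1)) (M F θ) (k + 1 + 1)).Dom → Set (Ec F θ))
  (A R r₁ : (F : T4Family) → Stage13HParams F 2 → ℝ) (Λ : (F : T4Family) → Stage13HParams F 2 → ℕ → ℕ → ℝ)
  (E₉ : (F : T4Family) → Stage13HParams F 2 → ℕ → ℕ → Type*) [∀ (F : T4Family) (θ : Stage13HParams F 2) (K k : ℕ), NormedAddCommGroup (E₉ F θ K k)]
  [∀ (F : T4Family) (θ : Stage13HParams F 2) (K k : ℕ), NormedSpace ℂ (E₉ F θ K k)]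
  (Wk : (F : T4Family) → (θ : Stage13HParams F 2) → (K k : ℕ) → Set (Fin (k + 1) → ℝ))
  (sp : (F : T4Family) → (θ : Stage13HParams F 2) → (K k : ℕ) → (domSys (F.P K) (M F θ) (k + 1)).Dom → Set (CPair (F.P K) (MatA 2)))
  (ι₉ : (F : T4Family) → (θ : Stage13HParams F 2) →
      (letI := θ.instVβ₁; letI := θ.instVβ₂;
      (K k : ℕ) → (domSys (F.P K) (M F θ) (k + 1)).Dom → ((Fin (F.P K).d → Site (F.P K) (k + 1) → θ.Vβ) →L[ℝ] E₉ F θ K k)))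
  (Φ : (F : T4Family) → (θ : Stage13HParams F 2) → (K k : ℕ) → (domSys (F.P K) (M F θ) (k + 1)).Dom → E₉ F θ K k → CPair (F.P K) (MatA 2))
  (U₉ : (F : T4Family) → (θ : Stage13HParams F 2) → (K k : ℕ) → (domSys (F.P K) (M F θ) (k + 1)).Dom → Set (E₉ F θ K k))
  (wt : (F : T4Family) → (θ : Stage13HParams F 2) → (K k : ℕ) → (domSys (F.P K) (M F θ) (k + 1)).Dom → Site (F.P K) (k + 1) → ℝ)

open Classical in
/-- ★★★ **THE ITEM `SpineGivenEndpointR13SepCoPHV` AT EVERY VERSION SLOT — LIVE: ALL PINS, EVERY SLOT AT ITS PRODUCER, N19′ AT THE BARE LEDGER READING, ALL FIVE OF NODE U3's LETTER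
ROWS FROM THE TERM-DATA PACKAGE + W1's THREE SLOTS; OFF-LIVE: ONE (B)-FREE TARGET ROW** (`N = 2`, `hP := h.toCore`; `hr ∕ hinc ∕ hS :=` dag-n18-w2's
`u3LettersOfRecord₁₃_of_termwiseLocalTermData`, `h9 ∕ hWall :=` dag-n22-w2's `windowedNE9OfRecord₁₃_letterRow_of_activitySlots` ∕ `windowedDecayOfRecord₁₃_letterRow_of_activitySlots`
with `hHhol` from PRINTED `AnalyticH` by dag-n22-c's `differentiableOn_H_comp_of_analyticH`, all at `θ.toStage13Params` over ONE `S emb hloc` and carried to `ℓ F θ` by the DOMINATION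
rows `hℓκ hℓθ hℓC hℓΛ`; live = APBᴮ §1 at `Rg := guard ∧ LiveSel`; off-live = (Kꜰ)ᴮ at `crOneTerm₁₃ K₀`; FILE 1's split at `Node00.datumOfRecord₁₃SepCoPHV F 2 θ h v`).  NOT a discharge;
every row a HYPOTHESIS or a decided MODEL, asserted for no family; N11 NOT READ; no node discharged; K3⁸ OPEN. [bookkeeping] -/
theorem spineGivenEndpointR13SepCoPHV_of_liveV5PinsAtCrOfRecord₁₃VAt_cut_bareLedgerReadingV_offLiveOneTerm_v5pins_bFree_u3TermData_w1Slots
    (ksel : (F : T4Family) → (θ : Stage13HParams F 2) → θ.Provisos₁₃CoPH F 2 → (ℕ → ℝ) → List (ULoop F) → ℕ)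
    (hpin1 : Ne1PinnedOfRecord 𝔯)
    (hpin2 : ∃ (b aS : ℝ) (ν μ α β' : Fin 4) (c35 p : ℝ), 0 < b ∧ 0 < aS ∧
      ∀ (F : T4Family) (θ : Stage13HParams F 2) (hP : θ.Provisos₁₃CoPH F 2) (g₀ : ℕ → ℝ) (os : List (ULoop F)) (k : ℕ),
        (𝔯.lit F θ hP g₀ os).ne2 k = haveI := neZero_blockFactor F; fullGSizedObjects 3 F.hL b aS ν μ α β' c35 p)
    (hpinL : N16PinnedLoose 𝔯 ℓ₃ B)
    (hpin : ∀ (F : T4Family) (θ : Stage13HParams F 2) (hP : θ.Provisos₁₃CoPH F 2) (g₀ : ℕ → ℝ) (os : List (ULoop F)),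
      (𝔯.lit F θ hP g₀ os).u3 = objectsOfRecord₁₃ F 2 θ.toStage13Params (ℓ F θ))
    (h16 : ∀ (F : T4Family), (∃ θ : Stage13HParams F 2, θ.Provisos₁₃CoPH F 2 ∧ (θ.ZhUnity F 2 ∧ θ.SlotsNondegenerate₁₃ F 2) ∧ θ.Admissible F 2) →
      N16HolderAt (ne3OfRecord₁₁ F { ne3ConstLayerOfRecord₁₁ F 2 (ℓ₃ F) with
        dom := {V | V ∈ ne3DomOfRecord₁₁ F 2 0 0 ∧ V ∈ sfClass 4 F.L (ne3NperOfRecord₁₁ F 0 0) ((ℓ₃ F).ε / B F) 0} }) β)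
    (hs : ∀ (F : T4Family) (θ : Stage13HParams F 2), θ.Provisos₁₃CoPH F 2 → (θ.ZhUnity F 2 ∧ θ.SlotsNondegenerate₁₃ F 2) → θ.Admissible F 2 → (ℓ F θ).Signs)
    (hκ : ∀ (F : T4Family) (θ : Stage13HParams F 2), θ.Provisos₁₃CoPH F 2 → (θ.ZhUnity F 2 ∧ θ.SlotsNondegenerate₁₃ F 2) → θ.Admissible F 2 → 0 < (ℓ F θ).κ)
    (hcr : ∀ (F : T4Family) (θ : Stage13HParams F 2), θ.Provisos₁₃CoPH F 2 → (θ.ZhUnity F 2 ∧ θ.SlotsNondegenerate₁₃ F 2) → θ.Admissible F 2 →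
      betaPrime510 4 1 (ℓ F θ).κ ≤ (ℓ F θ).cr)
    (hκ₀ : ∀ (F : T4Family) (θ : Stage13HParams F 2), θ.Provisos₁₃CoPH F 2 → (θ.ZhUnity F 2 ∧ θ.SlotsNondegenerate₁₃ F 2) → θ.Admissible F 2 → kappa₀ (4 * 2 ^ 4) (2 * 4) ≤ (ℓ F θ).κ)
    (hM : ∀ (F : T4Family) (θ : Stage13HParams F 2), M F θ = F.L ^ m' F θ)
    (hloc : ∀ (F : T4Family) (θ : Stage13HParams F 2), θ.Provisos₁₃CoPH F 2 → (θ.ZhUnity F 2 ∧ θ.SlotsNondegenerate₁₃ F 2) → θ.Admissible F 2 →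
      Localizes17OfRecord₁₃ F 2 θ.toStage13Params (S F θ) (emb F θ))
    (hκ0 : ∀ (F : T4Family) (θ : Stage13HParams F 2), 0 < (κ F θ)) (hδ₀ : ∀ (F : T4Family) (θ : Stage13HParams F 2), 0 < (δ₀ F θ))
    (hκ4 : ∀ (F : T4Family) (θ : Stage13HParams F 2), kappa₀ (4 * 2 ^ 4) (2 * 4) ≤ (κ F θ) / 2 / 2) (hω : ∀ (F : T4Family) (θ : Stage13HParams F 2), 0 < (ω F θ))
    (hω1 : ∀ (F : T4Family) (θ : Stage13HParams F 2), (ω F θ) < 1) (hcρ : ∀ (F : T4Family) (θ : Stage13HParams F 2), 0 < (cρ F θ))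
    (hr0 : ∀ (F : T4Family) (θ : Stage13HParams F 2), 0 < (r F θ)) (hE₀ : ∀ (F : T4Family) (θ : Stage13HParams F 2), 0 ≤ (E₀ F θ))
    (hB₃ : ∀ (F : T4Family) (θ : Stage13HParams F 2), 0 ≤ (B₃ F θ)) (hU₁ : ∀ (F : T4Family) (θ : Stage13HParams F 2), ∀ g k K X, IsOpen ((U₁ F θ) g k K X))
    (hG₁ : ∀ (F : T4Family) (θ : Stage13HParams F 2), ∀ g k K X, DifferentiableOn ℂ ((G₁ F θ) g k K X) ((U₁ F θ) g k K X))
    (hrU₁ : ∀ (F : T4Family) (θ : Stage13HParams F 2), ∀ g k K X, Metric.ball (0 : Ec F θ) (r F θ) ⊆ (U₁ F θ) g k K X)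
    (hf₁ : ∀ (F : T4Family) (θ : Stage13HParams F 2), θ.Provisos₁₃CoPH F 2 → (θ.ZhUnity F 2 ∧ θ.SlotsNondegenerate₁₃ F 2) → θ.Admissible F 2 →
      (letI := θ.instVβ₁; letI := θ.instVβ₂;
      ∀ g ∈ Window θ.γ, ∀ (k K : ℕ) (X : (domSys (F.P K) (M F θ) (k + 1)).Dom) (B : Fin (F.P K).d → Site (F.P K) (k + 1) → θ.Vβ),
      expChart (fun W' => ((((S F θ) K) k).E (histPrefix g k) ((emb F θ) K k W') X).re) θ.ρ8 B = ((G₁ F θ) g k K X ((ι₁ F θ) g k K X B)).re))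
    (hsup₁ : ∀ (F : T4Family) (θ : Stage13HParams F 2), θ.Provisos₁₃CoPH F 2 → (θ.ZhUnity F 2 ∧ θ.SlotsNondegenerate₁₃ F 2) → θ.Admissible F 2 →
      ∀ g ∈ Window θ.γ, ∀ (k K : ℕ) (X : (domSys (F.P K) (M F θ) (k + 1)).Dom), ∀ ζ ∈ Metric.ball (0 : Ec F θ) (r F θ), ‖(G₁ F θ) g k K X ζ‖ ≤ (E₀ F θ) * Real.exp (-(κ F θ) * torusTreeLen X.1))
    (htail₁ : ∀ (F : T4Family) (θ : Stage13HParams F 2), θ.Provisos₁₃CoPH F 2 → (θ.ZhUnity F 2 ∧ θ.SlotsNondegenerate₁₃ F 2) → θ.Admissible F 2 →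
      (letI := θ.instVβ₁; letI := θ.instVβ₂; letI := θ.instιβ;
      ∀ (g : ℕ → ℝ) (k K : ℕ) (X : (domSys (F.P K) (M F θ) (k + 1)).Dom) (l : Fin (F.P K).d) (t : Site (F.P K) (k + 1)) (c : θ.ιβ),
      let e : Site (F.P K) (k + 1) → TPt 4 (domCount (F.P K) (M F θ) (k + 1) * (M F θ)) := fun x i => (ZMod.cast (x i) : ZMod (domCount (F.P K) (M F θ) (k + 1) * (M F θ)));
      ‖(ι₁ F θ) g k K X (Pi.single l (Pi.single t (θ.bV c)))‖ ≤ (B₃ F θ) * Real.exp (-(δ₀ F θ) * distCT (domCount (F.P K) (M F θ) (k + 1)) (M F θ) (e t) (nearT (M := M F θ) (e t) X))))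
    (hφ : ∀ (F : T4Family) (θ : Stage13HParams F 2), θ.Provisos₁₃CoPH F 2 → (θ.ZhUnity F 2 ∧ θ.SlotsNondegenerate₁₃ F 2) → θ.Admissible F 2 →
      ∀ k : ℕ, ∃ Km : ℕ, ∀ K, Km ≤ K → ∀ R : ℝ, 0 ≤ R → R ≤ (cρ F θ) * K →
      Set.BijOn ((φ F θ) k K)
      ↑(Finset.univ.filter (fun X : (domSys (F.P K) (M F θ) (k + 1)).Dom =>
      ¬ (R < torusTreeLen X.1 ∨ R < distCT (domCount (F.P K) (M F θ) (k + 1)) (M F θ)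
      (fun i : Fin 4 => (ZMod.cast (siteOfInt F K (k + 1) 0 i) : ZMod (domCount (F.P K) (M F θ) (k + 1) * (M F θ))))
      (nearT (M := M F θ) (fun i : Fin 4 => (ZMod.cast (siteOfInt F K (k + 1) 0 i) : ZMod (domCount (F.P K) (M F θ) (k + 1) * (M F θ)))) X))))
      ↑(Finset.univ.filter (fun X : (domSys (F.P (K + 1)) (M F θ) (k + 1)).Dom =>
      ¬ (R < torusTreeLen X.1 ∨ R < distCT (domCount (F.P (K + 1)) (M F θ) (k + 1)) (M F θ)
      (fun i : Fin 4 => (ZMod.cast (siteOfInt F (K + 1) (k + 1) 0 i) : ZMod (domCount (F.P (K + 1)) (M F θ) (k + 1) * (M F θ))))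
      (nearT (M := M F θ) (fun i : Fin 4 => (ZMod.cast (siteOfInt F (K + 1) (k + 1) 0 i) : ZMod (domCount (F.P (K + 1)) (M F θ) (k + 1) * (M F θ)))) X)))))
    (hterm : ∀ (F : T4Family) (θ : Stage13HParams F 2), θ.Provisos₁₃CoPH F 2 → (θ.ZhUnity F 2 ∧ θ.SlotsNondegenerate₁₃ F 2) → θ.Admissible F 2 →
      (letI := θ.instVβ₁; letI := θ.instVβ₂; letI := θ.instιβ;
      ∀ g ∈ Window θ.γ, ∀ (k : ℕ) (μ ν : Fin 4) (z : Fin 4 → ℤ), ∃ (Ks : ℕ) (A₁ : ℝ), 0 ≤ A₁ ∧ ∀ K, Ks ≤ K → ∀ R : ℝ, 0 ≤ R → R ≤ (cρ F θ) * K →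
      ∀ X ∈ Finset.univ.filter (fun X : (domSys (F.P K) (M F θ) (k + 1)).Dom =>
      ¬ (R < torusTreeLen X.1 ∨ R < distCT (domCount (F.P K) (M F θ) (k + 1)) (M F θ)
      (fun i : Fin 4 => (ZMod.cast (siteOfInt F K (k + 1) 0 i) : ZMod (domCount (F.P K) (M F θ) (k + 1) * (M F θ))))
      (nearT (M := M F θ) (fun i : Fin 4 => (ZMod.cast (siteOfInt F K (k + 1) 0 i) : ZMod (domCount (F.P K) (M F θ) (k + 1) * (M F θ)))) X))),
      |polScalar (fun W' => ((((S F θ) (K + 1)) k).E (histPrefix g k) ((emb F θ) (K + 1) k W') ((φ F θ) k K X)).re) θ.ρ8 θ.bV (Fin.cast (F.P_d (K + 1)).symm μ)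
      (siteOfInt F (K + 1) (k + 1) z) (Fin.cast (F.P_d (K + 1)).symm ν) (siteOfInt F (K + 1) (k + 1) 0) -
      polScalar (fun W' => ((((S F θ) K) k).E (histPrefix g k) ((emb F θ) K k W') X).re) θ.ρ8 θ.bV (Fin.cast (F.P_d K).symm μ) (siteOfInt F K (k + 1) z)
      (Fin.cast (F.P_d K).symm ν) (siteOfInt F K (k + 1) 0)| ≤ A₁ * (ω F θ) ^ K))
    (hθ₅ : ∀ (F : T4Family) (θ : Stage13HParams F 2), 0 ≤ (θ₅ F θ)) (hM₀ : ∀ (F : T4Family) (θ : Stage13HParams F 2), 0 ≤ (M₀ F θ)) (hU : ∀ (F : T4Family) (θ : Stage13HParams F 2), ∀ k w K X, IsOpen ((U F θ) k w K X))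
    (hGB : ∀ (F : T4Family) (θ : Stage13HParams F 2), ∀ k w K X, DifferentiableOn ℂ ((GB F θ) k w K X) ((U F θ) k w K X))
    (hGA : ∀ (F : T4Family) (θ : Stage13HParams F 2), ∀ k w K X, DifferentiableOn ℂ ((GA F θ) k w K X) ((U F θ) k w K X))
    (hrU : ∀ (F : T4Family) (θ : Stage13HParams F 2), ∀ k w K X, Metric.ball (0 : Ec F θ) (r F θ) ⊆ (U F θ) k w K X)
    (hfB : ∀ (F : T4Family) (θ : Stage13HParams F 2), θ.Provisos₁₃CoPH F 2 → (θ.ZhUnity F 2 ∧ θ.SlotsNondegenerate₁₃ F 2) → θ.Admissible F 2 →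
      (letI := θ.instVβ₁; letI := θ.instVβ₂;
      ∀ (k : ℕ) (w : Fin (k + 2) → ℝ), w ∈ Box θ.γ (k + 1) → ∀ (K : ℕ) (X : (domSys (F.P (K + 1)) (M F θ) (k + 1 + 1)).Dom) (B),
      expChart (fun W' => ((((S F θ) (K + 1)) (k + 1)).E w ((emb F θ) (K + 1) (k + 1) W') X).re) θ.ρ8 B = ((GB F θ) k w K X ((ιc F θ) k w K X B)).re))
    (hfA : ∀ (F : T4Family) (θ : Stage13HParams F 2), θ.Provisos₁₃CoPH F 2 → (θ.ZhUnity F 2 ∧ θ.SlotsNondegenerate₁₃ F 2) → θ.Admissible F 2 →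
      (letI := θ.instVβ₁; letI := θ.instVβ₂;
      ∀ (k : ℕ) (w : Fin (k + 2) → ℝ), w ∈ Box θ.γ (k + 1) → ∀ (K : ℕ) (X : (domSys (F.P (K + 1)) (M F θ) (k + 1 + 1)).Dom) (B),
      expChart (fun W' : Fin (F.P (K + 1)).d → Site (F.P (K + 1)) (k + 1 + 1) → MatA 2 =>
      ((((S F θ) K) k).E (Fin.tail w) ((emb F θ) K k (fun κ' y => W' κ' (siteShift (ladder F K k) y))) (castDom (domSys_succ F (M F θ) K (k + 1)) X)).re) θ.ρ8 B =
      ((GA F θ) k w K X ((ιc F θ) k w K X B)).re))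
    (hsup : ∀ (F : T4Family) (θ : Stage13HParams F 2), θ.Provisos₁₃CoPH F 2 → (θ.ZhUnity F 2 ∧ θ.SlotsNondegenerate₁₃ F 2) → θ.Admissible F 2 →
      ∀ (k : ℕ) (w : Fin (k + 2) → ℝ), w ∈ Box θ.γ (k + 1) → ∀ (K : ℕ) (X : (domSys (F.P (K + 1)) (M F θ) (k + 1 + 1)).Dom), ∀ ζ ∈ Metric.ball (0 : Ec F θ) (r F θ),
      ‖(GB F θ) k w K X ζ - (GA F θ) k w K X ζ‖ ≤ (M₀ F θ) * (θ₅ F θ) ^ (k + 1) * Real.exp (-(κ F θ) * torusTreeLen X.1))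
    (htail : ∀ (F : T4Family) (θ : Stage13HParams F 2), θ.Provisos₁₃CoPH F 2 → (θ.ZhUnity F 2 ∧ θ.SlotsNondegenerate₁₃ F 2) → θ.Admissible F 2 →
      (letI := θ.instVβ₁; letI := θ.instVβ₂; letI := θ.instιβ;
      ∀ (k : ℕ) (w : Fin (k + 2) → ℝ) (K : ℕ) (X : (domSys (F.P (K + 1)) (M F θ) (k + 1 + 1)).Dom) (l : Fin (F.P (K + 1)).d) (t : Site (F.P (K + 1)) (k + 1 + 1)) (c : θ.ιβ),
      let e : Site (F.P (K + 1)) (k + 1 + 1) → TPt 4 (domCount (F.P (K + 1)) (M F θ) (k + 1 + 1) * (M F θ)) :=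
      fun x i => (ZMod.cast (x i) : ZMod (domCount (F.P (K + 1)) (M F θ) (k + 1 + 1) * (M F θ)));
      ‖(ιc F θ) k w K X (Pi.single l (Pi.single t (θ.bV c)))‖ ≤ (B₃ F θ) * Real.exp (-(δ₀ F θ) * distCT (domCount (F.P (K + 1)) (M F θ) (k + 1 + 1)) (M F θ) (e t) (nearT (M := M F θ) (e t) X))))
    (hℓκ : ∀ (F : T4Family) (θ : Stage13HParams F 2), θ.Provisos₁₃CoPH F 2 → (θ.ZhUnity F 2 ∧ θ.SlotsNondegenerate₁₃ F 2) → θ.Admissible F 2 → (ℓ F θ).κ ≤ delta1 (δ₀ F θ) (κ F θ) ((M F θ : ℝ) * 4))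
    (hℓθ : ∀ (F : T4Family) (θ : Stage13HParams F 2), θ.Provisos₁₃CoPH F 2 → (θ.ZhUnity F 2 ∧ θ.SlotsNondegenerate₁₃ F 2) → θ.Admissible F 2 → θ₅ F θ ≤ (ℓ F θ).θ₅)
    (hℓC : ∀ (F : T4Family) (θ : Stage13HParams F 2), θ.Provisos₁₃CoPH F 2 → (θ.ZhUnity F 2 ∧ θ.SlotsNondegenerate₁₃ F 2) → θ.Admissible F 2 →
      16 * M₀ F θ * B₃ F θ ^ 2 / r F θ ^ 2 * Real.exp (delta1 (δ₀ F θ) (κ F θ) ((M F θ : ℝ) * 4) * ((M F θ : ℝ) * 4) * 3) * B12TreeDecay.K₀ (4 * 2 ^ 4) (2 * 4) * K₁ 4 (δ₀ F θ / 2) * θ₅ F θ ≤ (ℓ F θ).C₅ * (ℓ F θ).θ₅)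
    (hWk : ∀ (F : T4Family) (θ : Stage13HParams F 2), ∀ g ∈ Window θ.γ, ∀ K k, histPrefix g k ∈ (Wk F θ) K k) (hA : ∀ (F : T4Family) (θ : Stage13HParams F 2), 0 < (A F θ))
    (hr₁ : ∀ (F : T4Family) (θ : Stage13HParams F 2), 0 ≤ (r₁ F θ)) (hκr₁ : ∀ (F : T4Family) (θ : Stage13HParams F 2), (κ F θ) ≤ (r₁ F θ))
    (hrate : ∀ (F : T4Family) (θ : Stage13HParams F 2), (r₁ F θ) + 2 * (64 * Real.log 162) + 2 ≤ (R F θ))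
    (hsmall : ∀ (F : T4Family) (θ : Stage13HParams F 2), 2 * (A F θ) * Real.exp (5 * (r₁ F θ) + 1) * B12TreeDecay.K₀ 64 8 * 9 * 64 ≤ 1) (hΛ : ∀ (F : T4Family) (θ : Stage13HParams F 2), ∀ k i, 0 ≤ (Λ F θ) k i)
    (h238 : ∀ (F : T4Family) (θ : Stage13HParams F 2), θ.Provisos₁₃CoPH F 2 → (θ.ZhUnity F 2 ∧ θ.SlotsNondegenerate₁₃ F 2) → θ.Admissible F 2 →
      ∀ K k, (((S F θ) K) k).Bound238 ((Wk F θ) K k) ((sp F θ) K k) (A F θ) (R F θ))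
    (hYL : ∀ (F : T4Family) (θ : Stage13HParams F 2), θ.Provisos₁₃CoPH F 2 → (θ.ZhUnity F 2 ∧ θ.SlotsNondegenerate₁₃ F 2) → θ.Admissible F 2 →
      ∀ K k, (((S F θ) K) k).YoungLipschitz ((Wk F θ) K k) ((sp F θ) K k) (fun i : Fin (k + 1) => (Λ F θ) (k + 1) i) (R F θ))
    (hAn : ∀ (F : T4Family) (θ : Stage13HParams F 2), θ.Provisos₁₃CoPH F 2 → (θ.ZhUnity F 2 ∧ θ.SlotsNondegenerate₁₃ F 2) → θ.Admissible F 2 → ∀ K k, ((S F θ K) k).AnalyticH (Wk F θ K k) (sp F θ K k))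
    (hU₉ : ∀ (F : T4Family) (θ : Stage13HParams F 2), ∀ K k X, IsOpen ((U₉ F θ) K k X)) (hrU₉ : ∀ (F : T4Family) (θ : Stage13HParams F 2), ∀ K k X, Metric.ball (0 : E₉ F θ K k) (r F θ) ⊆ (U₉ F θ) K k X)
    (hΦhol : ∀ (F : T4Family) (θ : Stage13HParams F 2), ∀ (K k : ℕ) (X : (domSys (F.P K) (M F θ) (k + 1)).Dom), DifferentiableOn ℂ ((Φ F θ) K k X) ((U₉ F θ) K k X))
    (hΦemb : ∀ (F : T4Family) (θ : Stage13HParams F 2), θ.Provisos₁₃CoPH F 2 → (θ.ZhUnity F 2 ∧ θ.SlotsNondegenerate₁₃ F 2) → θ.Admissible F 2 →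
      (letI := θ.instVβ₁; letI := θ.instVβ₂;
      ∀ (K k : ℕ) (X : (domSys (F.P K) (M F θ) (k + 1)).Dom) (B : Fin (F.P K).d → Site (F.P K) (k + 1) → θ.Vβ),
      (Φ F θ) K k X ((ι₉ F θ) K k X B) = (emb F θ) K k (fun l t => NormedSpace.exp (θ.ρ8 (B l t)))))
    (hΦsp : ∀ (F : T4Family) (θ : Stage13HParams F 2), θ.Provisos₁₃CoPH F 2 → (θ.ZhUnity F 2 ∧ θ.SlotsNondegenerate₁₃ F 2) → θ.Admissible F 2 →
      ∀ (K k : ℕ) (X : (domSys (F.P K) (M F θ) (k + 1)).Dom), ∀ z ∈ (U₉ F θ) K k X, ∀ Z : (domSys (F.P K) (M F θ) (k + 1)).Dom, Z.1 ⊆ X.1 → (Φ F θ) K k X z ∈ (sp F θ) K k Z)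
    (hwt₀ : ∀ (F : T4Family) (θ : Stage13HParams F 2), ∀ K k X t, 0 ≤ (wt F θ) K k X t)
    (hwt : ∀ (F : T4Family) (θ : Stage13HParams F 2), θ.Provisos₁₃CoPH F 2 → (θ.ZhUnity F 2 ∧ θ.SlotsNondegenerate₁₃ F 2) → θ.Admissible F 2 →
      (letI := θ.instVβ₁; letI := θ.instVβ₂; letI := θ.instιβ;
      ∀ (K k : ℕ) (X : (domSys (F.P K) (M F θ) (k + 1)).Dom) (l : Fin (F.P K).d) (t : Site (F.P K) (k + 1)) (c : θ.ιβ),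
      ‖(ι₉ F θ) K k X (Pi.single l (Pi.single t (θ.bV c)))‖ ≤ (wt F θ) K k X t))
    (htail₉ : ∀ (F : T4Family) (θ : Stage13HParams F 2), θ.Provisos₁₃CoPH F 2 → (θ.ZhUnity F 2 ∧ θ.SlotsNondegenerate₁₃ F 2) → θ.Admissible F 2 →
      ∀ (K k : ℕ) (X : (domSys (F.P K) (M F θ) (k + 1)).Dom) (t : Site (F.P K) (k + 1)),
      let e : Site (F.P K) (k + 1) → TPt 4 (domCount (F.P K) (M F θ) (k + 1) * (M F θ)) := fun x i => (ZMod.cast (x i) : ZMod (domCount (F.P K) (M F θ) (k + 1) * (M F θ)));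
      (wt F θ) K k X t ≤ (B₃ F θ) * Real.exp (-(δ₀ F θ) * distCT (domCount (F.P K) (M F θ) (k + 1)) (M F θ) (e t) (nearT (M := M F θ) (e t) X)))
    (hℓΛ : ∀ (F : T4Family) (θ : Stage13HParams F 2), θ.Provisos₁₃CoPH F 2 → (θ.ZhUnity F 2 ∧ θ.SlotsNondegenerate₁₃ F 2) → θ.Admissible F 2 →
      ∀ k i, (16 * (8 * (Real.exp 1 * 9 * 64 * B12TreeDecay.K₀ 64 8 ^ 2)) * (B₃ F θ) ^ 2 / (r F θ) ^ 2) *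
      Real.exp (delta1 (δ₀ F θ) (κ F θ) (((M F θ) : ℝ) * 4) * (((M F θ) : ℝ) * 4) * 3) * B12TreeDecay.K₀ (4 * 2 ^ 4) (2 * 4) * K₁ 4 ((δ₀ F θ) / 2) * (Λ F θ) k i ≤ (ℓ F θ).moduli k i)
    (hβ23 : 2 / 3 < β) (hβ1 : β ≤ 1) (hmatch : ∀ F : T4Family, 0 < B F ∧ (ℓ₃ F).ε / B F ≤ (ℓ₃ F).b)
    (hend : N16LettersEnd 2 g ℓ₃)
    (hradii : ∀ F : T4Family, (ℓ₃ F).g = gradConst 4 (c' F) ∧ 0 ≤ c' F ∧ 0 < c' F ∧ (ℓ₃ F).b ≤ c' F ∧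
      (2 : ℝ) ^ 91 * (F.L : ℝ) ^ 17 * c' F ≤ 1 ∧ (2 : ℝ) ^ 76 * (F.L : ℝ) ^ 12 * c' F ≤ (ℓ₃ F).ε ∧ (ℓ₃ F).ε / B F ≤ 1 / 4 ∧ 4 * ((ℓ₃ F).ε / B F) ≤ c' F)
    (hclass : ∀ F : T4Family, 16 * B7Prop2Explicit.C0 4 * (ℓ₃ F).ε ≤ 3 ∧ 1024 * (4 + 1) * (4 + 4) * (F.L : ℝ) ^ 2 * (ℓ₃ F).ε ≤ 1)
    (hH3 : ∀ (F : T4Family) (θ : Stage13HParams F 2) (hP : θ.Provisos₁₃CoPH F 2) (g₀ : ℕ → ℝ) (os : List (ULoop F)) (k : ℕ),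
      LeafH3sup 4 (rateCarriersOfRecord₁₃CoPH 𝔯 F θ hP g₀ os k).ne3.L (rateCarriersOfRecord₁₃CoPH 𝔯 F θ hP g₀ os k).ne3.Nper (rateCarriersOfRecord₁₃CoPH 𝔯 F θ hP g₀ os k).ne3.ε
        (rateCarriersOfRecord₁₃CoPH 𝔯 F θ hP g₀ os k).ne3.b (c' F) (rateCarriersOfRecord₁₃CoPH 𝔯 F θ hP g₀ os k).ne3.dom)
    (hsel3 : ∀ (F : T4Family) (θ : Stage13HParams F 2) (hP : θ.Provisos₁₃CoPH F 2) (g₀ : ℕ → ℝ) (os : List (ULoop F)) (k : ℕ),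
      ∃ sel : ℕ → (B7Prop1Explicit.Site 4 → Fin 4 → (Matrix (Fin 2) (Fin 2) ℂ)ˣ) → (B7Prop1Explicit.Site 4 → Fin 4 → (Matrix (Fin 2) (Fin 2) ℂ)ˣ),
        (∀ V ∈ (rateCarriersOfRecord₁₃CoPH 𝔯 F θ hP g₀ os k).ne3.dom, ∀ j : ℕ,
          IsMinimiser 4 (sfClass 4 (rateCarriersOfRecord₁₃CoPH 𝔯 F θ hP g₀ os k).ne3.L (rateCarriersOfRecord₁₃CoPH 𝔯 F θ hP g₀ os k).ne3.Nper (rateCarriersOfRecord₁₃CoPH 𝔯 F θ hP g₀ os k).ne3.ε)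
            (rateCarriersOfRecord₁₃CoPH 𝔯 F θ hP g₀ os k).ne3.L (rateCarriersOfRecord₁₃CoPH 𝔯 F θ hP g₀ os k).ne3.Nper j V (sel j V)) ∧
        (∀ V ∈ (rateCarriersOfRecord₁₃CoPH 𝔯 F θ hP g₀ os k).ne3.dom, ∀ j : ℕ,
          RegularSup 4 (rateCarriersOfRecord₁₃CoPH 𝔯 F θ hP g₀ os k).ne3.L (rateCarriersOfRecord₁₃CoPH 𝔯 F θ hP g₀ os k).ne3.Nper (rateCarriersOfRecord₁₃CoPH 𝔯 F θ hP g₀ os k).ne3.b (c' F) j (sel j V)))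
    (hβw : ∀ (F : T4Family) (θ : Stage13HParams F 2) (hP : θ.Provisos₁₃CoPH F 2), (θ.ZhUnity F 2 ∧ θ.SlotsNondegenerate₁₃ F 2) → θ.Admissible F 2 →
      ∃ γ₀ b b' : ℝ, 0 < γ₀ ∧ 0 < b ∧ DagBinding.BetaBoundsInInterval (datumOfRecord₁₃CoPH F 2 θ hP).C.toB12 γ₀ b b')
    (hζm : ∀ (F : T4Family) (θ : Stage13HParams F 2), θ.Provisos₁₃CoPH F 2 → ((θ.ZhUnity F 2 ∧ θ.SlotsNondegenerate₁₃ F 2) ∧ θ.ppSel = ppSelLiveOfRecord F 2 θ.ν θ.τ9 (EOfRecord₁₃ F 2 θ.toStage13Params) (wOfRecord₉ F 2 θ.toStage9Params)) → θ.Admissible F 2 →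
      ZetaMeasurable F 2 θ.ζ)
    (h20 : ∀ (F : T4Family) (θ : Stage13HParams F 2) (hP : θ.Provisos₁₃CoPH F 2), ((θ.ZhUnity F 2 ∧ θ.SlotsNondegenerate₁₃ F 2) ∧ θ.ppSel = ppSelLiveOfRecord F 2 θ.ν θ.τ9 (EOfRecord₁₃ F 2 θ.toStage13Params) (wOfRecord₉ F 2 θ.toStage9Params)) → θ.Admissible F 2 →
      ∀ (g₀ : ℕ → ℝ) (os : List (ULoop F)),
        ∃ W : ℕ → ℝ, RelWeightBound 1 (classSet₁₃ θ K₀ g₀) (weightA₁₃ θ hP K₀ g₀ os) (weightB₁₃ θ hP K₀ g₀ os) (badClass₁₃ θ K₀ g₀ (jc F θ hP g₀ os)) W)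
    (h21 : ∀ (F : T4Family) (θ : Stage13HParams F 2) (hP : θ.Provisos₁₃CoPH F 2), ((θ.ZhUnity F 2 ∧ θ.SlotsNondegenerate₁₃ F 2) ∧ θ.ppSel = ppSelLiveOfRecord F 2 θ.ν θ.τ9 (EOfRecord₁₃ F 2 θ.toStage13Params) (wOfRecord₉ F 2 θ.toStage9Params)) → θ.Admissible F 2 →
      ∀ (g₀ : ℕ → ℝ) (os : List (ULoop F)),
        ∃ Wsh : ℕ → ℝ, ShellWeightBound 1 (classSet₁₃ θ K₀ g₀) (weightA₁₃ θ hP K₀ g₀ os) (weightB₁₃ θ hP K₀ g₀ os) (sh F θ hP g₀ os).1 (sh F θ hP g₀ os).2 Wsh)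
    (hlinkBareV : ∀ (F : T4Family) (θ : Stage13HParams F 2) (hP : θ.Provisos₁₃CoPH F 2), ((θ.ZhUnity F 2 ∧ θ.SlotsNondegenerate₁₃ F 2) ∧ θ.ppSel = ppSelLiveOfRecord F 2 θ.ν θ.τ9 (EOfRecord₁₃ F 2 θ.toStage13Params) (wOfRecord₉ F 2 θ.toStage9Params)) → θ.Admissible F 2 →
      ∀ (γ gIR b : ℝ) (g₀ : ℕ → ℝ), (datumOfRecord₁₃CoPH F 2 θ hP).Tuned γ gIR g₀ → γ ≤ θ.γ → γ ^ 2 ≤ Real.exp (-1) → 0 < b →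
      (∀ K m, 0 ≤ m → m < K → b ≤ (datumOfRecord₁₃CoPH F 2 θ hP).βfun m (prefixOf (runFlow (datumOfRecord₁₃CoPH F 2 θ hP) g₀ K) m)) →
      ∀ (os : List (ULoop F)) (k : ℕ),
      let S : SpineCarriers := crOfRecord₁₃VAt K₀ (jc F θ hP g₀ os) sh F θ hP g₀ os
      let R : RateCarriers 2 := rateCarriersOfRecord₁₃CoPH 𝔯 F θ hP g₀ os k
      let D : Datum F 2 := datumOfRecord₁₃CoPH F 2 θ hP
      letI := S.dec
      ∃ (_ : DecidableEq R.u3.C.Dom) (F' : Type) (ι' X' : Type) (_ : MeasurableSpace ι')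
        (L : LedgerDataSync R.u3.C F' ι' S.ι) (Rd : Readings ι' X') (bsel : (ℕ → ℝ) → ℝ) (EB : Functional R.u3.C R.u3.C.BgB)
        (g : ℕ → ℕ → ℝ)
        (uA : ℕ → ι' → R.u3.C.BgA) (uB : ℕ → ι' → R.u3.C.BgB)
        (Koff : ℕ) (cells : (K j : ℕ) → R.u3.C.Dom → Finset (Site (F.P (Koff + K)) j))
        (θ : ℝ)
        (rd : ι' → (B7Prop1Explicit.Site 4 → Fin 4 → (Matrix (Fin 2) (Fin 2) ℂ)ˣ)),
        (∀ K i, i ≤ K → g K i = runFlow D g₀ K i) ∧ (∀ K i, K < i → g K i = gIR) ∧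
        EB = (fun s => R.u3.EB (bsel s) s) ∧
        (∀ (Sz : ℕ → ℝ → S.ι → ℕ → ℝ) (E₀ : ℝ) (m : ℕ) (a : ℝ) (Cw Λg : ℝ),
          (∀ K t, |t| ≤ S.l₀ → ∀ τ ∈ S.T K \ S.Bad K t, ∀ v ∈ Rd.dom, ∀ j ≤ K,
            |∑ X ∈ L.fac K t τ with R.u3.C.scale X = j,
                (Real.log (Real.exp (EB (fun i => g (K + 1) (i + 1)) (uB K v) X
                    - EB (fun i => g (K + 1) (i + 1)) L.oneB X))
                  - Real.log (Real.exp (R.u3.EA (g K) (uA K v) X - R.u3.EA (g K) L.oneA X)))| ≤ Sz K t τ j) →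
          0 ≤ E₀ → 0 < a → a < 1 →
          (∀ K t, |t| ≤ S.l₀ → ∀ τ ∈ S.T K \ S.Bad K t, ∀ j ≤ K,
            Sz K t τ j ≤ S.vol * (E₀ * ((K : ℝ) + 1) ^ m * a ^ (K - j))) →
          (∀ K, Multiplicity (L.All K) R.u3.C.scale (fun X => Real.exp (-(R.u3.κ * R.u3.C.d X))) Cw S.vol Λg K) →
          (∀ K t, |t| ≤ S.l₀ → ∀ τ ∈ S.T K \ S.Bad K t,
            WindowMultiplicity (L.facO K t τ) L.scO L.wO Cw S.vol Λg (jlogOf L.Cl K) K) →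
          1 ≤ Λg → L.θ' ≤ Λg →
          LedgerAtSync { L with S := Sz, E₀ := E₀, m := m, a := a, Cw := Cw, Λg := Λg } S.l₀ S.vol S.T S.Bad
            (fun K t τ => S.A K t τ - S.shA K t τ) (fun K t τ => S.B K t τ - S.shB K t τ) Rd R.u3.EA EB R.u3.κ g uA uB
            R.u3.ω R.u3.ρ R.u3.θ (θ ^ ((3 : ℝ) * β - 2))) ∧
        (∀ K t, |t| ≤ S.l₀ → ∀ τ ∈ S.T K \ S.Bad K t,
          WindowMultiplicity (L.facO K t τ) L.scO L.wO L.Cw S.vol L.Λg (jlogOf L.Cl K) K) ∧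
        0 ≤ L.Cw ∧ 1 ≤ L.Λg ∧ L.θ' ≤ L.Λg ∧
        (∀ K, ∀ X ∈ L.All K,
          (cells K (R.u3.C.scale X + Koff) X).Nonempty ∧ TFaceConnected (cells K (R.u3.C.scale X + Koff) X)) ∧
        (∀ K j, Set.InjOn (cells K j) ↑((L.All K).filter fun X => R.u3.C.scale X + Koff = j)) ∧
        (∀ K, ∀ X ∈ L.All K, torusTreeLen (cells K (R.u3.C.scale X + Koff) X) ≤ R.u3.C.d X) ∧
        0 < θ ∧ θ ^ 6 = ((R.ne3.L : ℝ))⁻¹ ∧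
        (∀ v ∈ Rd.dom, rd v ∈ R.ne3.dom) ∧
        (∀ k, ∀ v ∈ Rd.dom, Rd.act k v = minAct 4 (sfClass 4 R.ne3.L R.ne3.Nper R.ne3.ε) R.ne3.L R.ne3.Nper k (rd v)) ∧
        (R.ne3.Nper : ℝ) ^ 4 ≤ Rd.vol ∧
        (∀ s ∈ Window γ, 0 < bsel s ∧ bsel s ≤ γ))
    (htarget : ∀ (F : T4Family) (θ : Stage13HParams F 2) (hP : θ.Provisos₁₃CoPH F 2), ((θ.ZhUnity F 2 ∧ θ.SlotsNondegenerate₁₃ F 2) ∧ ¬ θ.ppSel = ppSelLiveOfRecord F 2 θ.ν θ.τ9 (EOfRecord₁₃ F 2 θ.toStage13Params) (wOfRecord₉ F 2 θ.toStage9Params)) → θ.Admissible F 2 →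
        ForSmallCouplings (datumOfRecord₁₃CoPH F 2 θ hP) fun g₀ => ∀ os : List (ULoop F),
          (RatesHolderAt (datumOfRecord₁₃CoPH F 2 θ hP) (rateCarriersOfRecord₁₃CoPH 𝔯 F θ hP g₀ os (ksel F θ hP g₀ os)) β ∧
              ReadOutAt (datumOfRecord₁₃CoPH F 2 θ hP) (rateCarriersOfRecord₁₃CoPH 𝔯 F θ hP g₀ os (ksel F θ hP g₀ os)).u3 ∧
              (0 ≤ (rateCarriersOfRecord₁₃CoPH 𝔯 F θ hP g₀ os (ksel F θ hP g₀ os)).u3.ρ ∧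
                (rateCarriersOfRecord₁₃CoPH 𝔯 F θ hP g₀ os (ksel F θ hP g₀ os)).u3.ρ < 1)) →
            ∃ δ : ℕ → ℝ, Target ((F.side : ℝ) ^ 4) 1 δ (fun K => T4GenFunBounds.schemeZ ((datumOfRecord₁₃CoPH F 2 θ hP).scheme g₀) os (K₀ + K))) :
    SpineGivenEndpointR13SepCoPHV := by
  have hρ : ∀ (F : T4Family) (θ : Stage13HParams F 2), θ.Provisos₁₃CoPH F 2 → (θ.ZhUnity F 2 ∧ θ.SlotsNondegenerate₁₃ F 2) → θ.Admissible F 2 →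
      0 ≤ (ℓ F θ).ρ ∧ (ℓ F θ).ρ < 1 := fun F θ hP hG hθ => ⟨(hs F θ hP hG hθ).ρ_nonneg, (hs F θ hP hG hθ).ρ_lt_one⟩
  have hTD := fun (F : T4Family) (θ : Stage13HParams F 2) (hP : θ.Provisos₁₃CoPH F 2) (hG : (θ.ZhUnity F 2 ∧ θ.SlotsNondegenerate₁₃ F 2)) (hθ : θ.Admissible F 2) =>
    u3LettersOfRecord₁₃_of_termwiseLocalTermData F 2 (m' F θ) (M F θ) (hM F θ) θ.toStage13Params (S F θ) (emb F θ) (hloc F θ hP hG hθ) (hκ0 F θ) (hδ₀ F θ) (hκ4 F θ)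
      (hω F θ) (hω1 F θ) (hcρ F θ) (hr0 F θ) (hE₀ F θ) (hB₃ F θ) (ι₁ F θ) (G₁ F θ) (U₁ F θ) (hU₁ F θ) (hG₁ F θ) (hrU₁ F θ) (hf₁ F θ hP hG hθ) (hsup₁ F θ hP hG hθ)
      (htail₁ F θ hP hG hθ) (φ F θ) (hφ F θ hP hG hθ) (hterm F θ hP hG hθ) (hθ₅ F θ) (hM₀ F θ) (ιc F θ) (GB F θ) (GA F θ) (U F θ) (hU F θ) (hGB F θ) (hGA F θ) (hrU F θ)
      (hfB F θ hP hG hθ) (hfA F θ hP hG hθ) (hsup F θ hP hG hθ) (htail F θ hP hG hθ)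
  have hS' : ∀ (F : T4Family) (θ : Stage13HParams F 2), θ.Provisos₁₃CoPH F 2 → (θ.ZhUnity F 2 ∧ θ.SlotsNondegenerate₁₃ F 2) → θ.Admissible F 2 →
      WindowedStepRateOfRecord₁₃ F 2 θ.toStage13Params 1 (ℓ F θ).κ (ℓ F θ).θ₅ ((ℓ F θ).C₅ * (ℓ F θ).θ₅) := fun F θ hP hG hθ =>
    windowedStepRateOfRecord₁₃_mono F 2 θ.toStage13Params (hTD F θ hP hG hθ).2.2.2.1 (hℓκ F θ hP hG hθ) (hθ₅ F θ) (hℓθ F θ hP hG hθ) (hℓC F θ hP hG hθ)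
      (mul_nonneg (hs F θ hP hG hθ).C₅_nonneg (hs F θ hP hG hθ).θ₅_pos.le)
  have hκ2 : ∀ (F : T4Family) (θ : Stage13HParams F 2), kappa₀ (4 * 2 ^ 4) (2 * 4) ≤ κ F θ / 2 := fun F θ =>
    (hκ4 F θ).trans (by have := hκ0 F θ; linarith)
  have hsmall1 : ∀ (F : T4Family) (θ : Stage13HParams F 2), A F θ * Real.exp (5 * r₁ F θ + 1) * B12TreeDecay.K₀ 64 8 * 9 * 64 ≤ 1 := fun F θ => by
    have h2 := hsmall F θ
    have h0 : 0 ≤ A F θ * Real.exp (5 * r₁ F θ + 1) * B12TreeDecay.K₀ 64 8 :=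
      mul_nonneg (mul_nonneg (hA F θ).le (Real.exp_pos _).le) (B12TreeDecay.K₀_pos 64 8).le
    nlinarith
  have hHhol : ∀ (F : T4Family) (θ : Stage13HParams F 2), θ.Provisos₁₃CoPH F 2 → (θ.ZhUnity F 2 ∧ θ.SlotsNondegenerate₁₃ F 2) → θ.Admissible F 2 →
      ∀ g ∈ Window θ.γ, ∀ (K k : ℕ) (X Z : (domSys (F.P K) (M F θ) (k + 1)).Dom), Z.1 ⊆ X.1 →
        DifferentiableOn ℂ (fun z => ((S F θ K) k).H (histPrefix g k) (Φ F θ K k X z) Z) (U₉ F θ K k X) := fun F θ hP hG hθ g hg K k X =>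
    differentiableOn_H_comp_of_analyticH ((S F θ K) k) (Wk F θ K k) (sp F θ K k) (hAn F θ hP hG hθ K k) (hWk F θ g hg K k) (Φ F θ K k X) (hΦhol F θ K k X) X
      (hΦsp F θ hP hG hθ K k X)
  have h9' := fun (F : T4Family) (θ : Stage13HParams F 2) (hP : θ.Provisos₁₃CoPH F 2) (hG : (θ.ZhUnity F 2 ∧ θ.SlotsNondegenerate₁₃ F 2)) (hθ : θ.Admissible F 2) =>
    windowedNE9OfRecord₁₃_letterRow_of_activitySlots F 2 θ.toStage13Params (ℓ F θ) (hs F θ hP hG hθ) (m' F θ) (M F θ) (hM F θ) (S F θ) (emb F θ)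
      (hloc F θ hP hG hθ) (Wk F θ) (hWk F θ) (sp F θ) (Λ F θ) (hA F θ) (hr₁ F θ) (hκr₁ F θ) (hκ2 F θ) (hrate F θ) (hsmall F θ) (hΛ F θ) (hδ₀ F θ) (hB₃ F θ) (hr0 F θ)
      (h238 F θ hP hG hθ) (hYL F θ hP hG hθ) (E₉ F θ) (ι₉ F θ) (Φ F θ) (U₉ F θ) (hU₉ F θ) (hrU₉ F θ) (hHhol F θ hP hG hθ) (hΦemb F θ hP hG hθ) (hΦsp F θ hP hG hθ) (wt F θ) (hwt₀ F θ)
      (hwt F θ hP hG hθ) (htail₉ F θ hP hG hθ) (hℓκ F θ hP hG hθ) (hℓΛ F θ hP hG hθ)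
  have hW' := fun (μ ν : Fin 4) (F : T4Family) (θ : Stage13HParams F 2) (hP : θ.Provisos₁₃CoPH F 2) (hG : (θ.ZhUnity F 2 ∧ θ.SlotsNondegenerate₁₃ F 2)) (hθ : θ.Admissible F 2) =>
    windowedDecayOfRecord₁₃_letterRow_of_activitySlots F 2 θ.toStage13Params (ℓ F θ) (m' F θ) (M F θ) (hM F θ) (S F θ) (emb F θ) (hloc F θ hP hG hθ)
      (Wk F θ) (hWk F θ) (sp F θ) (hA F θ).le (hr₁ F θ) (hκr₁ F θ) (hκ2 F θ) (hrate F θ) (hsmall1 F θ) (hδ₀ F θ) (hB₃ F θ) (hr0 F θ) (h238 F θ hP hG hθ) (E₉ F θ) (ι₉ F θ) (Φ F θ)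
      (U₉ F θ) (hU₉ F θ) (hrU₉ F θ) (hHhol F θ hP hG hθ) (hΦemb F θ hP hG hθ) (hΦsp F θ hP hG hθ) (wt F θ) (hwt₀ F θ) (hwt F θ hP hG hθ) (htail₉ F θ hP hG hθ) (hℓκ F θ hP hG hθ) μ ν
  have hUK := fun (F : T4Family) (θ : Stage13HParams F 2) (hP : θ.Provisos₁₃CoPH F 2) (hG : (θ.ZhUnity F 2 ∧ θ.SlotsNondegenerate₁₃ F 2)) (hθ : θ.Admissible F 2) =>
    u3KernelInputs_of_finiteVolumeLetters F 2 θ.toStage13Params (ℓ F θ) (hs F θ hP hG hθ) 1 (hTD F θ hP hG hθ).1 (hTD F θ hP hG hθ).2.1 (hS' F θ hP hG hθ)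
      (h9' F θ hP hG hθ) (hW' 0 1 F θ hP hG hθ)
  exact fun F θ h v hG hθ _ _ =>
    hybridNE7Under_of_forSmallCouplings_stringwise (Node00.datumOfRecord₁₃SepCoPHV F 2 θ h v)
      (show ForSmallCouplings (Node00.datumOfRecord₁₃SepCoPHV F 2 θ h v) (fun g₀ => StringwiseHybridNE7 ((Node00.datumOfRecord₁₃SepCoPHV F 2 θ h v).scheme g₀)) from
        bodyBFree₁₃CoPH_of_split (fun F (θ : Stage13HParams F 2) => (θ.ZhUnity F 2 ∧ θ.SlotsNondegenerate₁₃ F 2)) (fun F (θ : Stage13HParams F 2) => θ.ppSel = ppSelLiveOfRecord F 2 θ.ν θ.τ9 (EOfRecord₁₃ F 2 θ.toStage13Params) (wOfRecord₉ F 2 θ.toStage9Params))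
          (bodyBFree₁₃CoPH_of_v5pins_bareLedgerReadingV_at_crOfRecord₁₃VAt_cut K₀ jc sh β 𝔯 ℓ (fun _ _ => 1)
            (fun F θ => max (Real.exp (Real.log (ω F θ) / 2)) (Real.exp (-(min (κ F θ) (δ₀ F θ) / 2) * (-Real.log (ω F θ) / (2 * (max (2 * kappa₀ (4 * 2 ^ 4) (2 * 4) + 4) (-Real.log (ω F θ) / (2 * cρ F θ)) + 1)))))) ℓ₃ g B c'
          (fun F (θ : Stage13HParams F 2) => (θ.ZhUnity F 2 ∧ θ.SlotsNondegenerate₁₃ F 2) ∧ θ.ppSel = ppSelLiveOfRecord F 2 θ.ν θ.τ9 (EOfRecord₁₃ F 2 θ.toStage13Params) (wOfRecord₉ F 2 θ.toStage9Params))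
          ksel hpin1 hpin2 hpinL hpin (fun F hF => h16 F (hF.elim fun θ h => ⟨θ, h.1, h.2.1.1, h.2.2⟩)) (fun F θ hP hRg hθ => hs F θ hP hRg.1 hθ) (fun F θ hP hRg hθ => hκ F θ hP hRg.1 hθ)
          (fun F θ hP hRg hθ => hcr F θ hP hRg.1 hθ) (fun F θ hP hRg hθ => hκ₀ F θ hP hRg.1 hθ) (fun F θ hP hRg hθ => (hTD F θ hP hRg.1 hθ).1)
          (fun F θ hP hRg hθ => (hTD F θ hP hRg.1 hθ).2.1)
          (fun F θ hP hRg hθ => hS' F θ hP hRg.1 hθ) (fun F θ hP hRg hθ => h9' F θ hP hRg.1 hθ) (fun μ ν F θ hP hRg hθ => hW' μ ν F θ hP hRg.1 hθ) hβ23 hβ1 hmatch hend hradii hclass hH3 hsel3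
          (fun F θ hP hRg hθ => hβw F θ hP hRg.1 hθ) (fun _ _ _ hRg _ => ⟨_, hRg.2⟩) hζm h20 h21 hlinkBareV)
          (bodyBFree₁₃CoPH_of_kernels_pin_bFree (crOneTerm₁₃ K₀) 𝔯 ksel (fun {F} (θ : Stage13HParams F 2) => ((θ.ZhUnity F 2 ∧ θ.SlotsNondegenerate₁₃ F 2) ∧ ¬ θ.ppSel = ppSelLiveOfRecord F 2 θ.ν θ.τ9 (EOfRecord₁₃ F 2 θ.toStage13Params) (wOfRecord₉ F 2 θ.toStage9Params))) ℓ β hpin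
            (fun F θ hP hRg hθ => ForSmallCouplings.of_forall fun g₀ os => by
              refine ⟨?_, ?_, ?_⟩
              · exact n14At_rateCarriersOfRecord₁₃CoPH_of_pinned 𝔯 hpin1 F θ hP g₀ os (ksel F θ hP g₀ os)
              · obtain ⟨b, aS, ν, μ, α, β', c35, p, hb, haS, h⟩ := hpin2
                rw [h F θ hP g₀ os]
                exact n15At_fullGSizedObjects_family hb haS ν μ α β' c35 p F
              · show N16HolderAt (rateCarriersOfRecord₁₃CoPH 𝔯 F θ hP g₀ os (ksel F θ hP g₀ os)).ne3 β
                rw [rateCarriers_ne3_of_pinnedLoose hpinL F θ hP g₀ os (ksel F θ hP g₀ os)]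
                exact h16 F ⟨θ, hP, hRg.1, hθ⟩)
            (fun F θ hP hRg hθ => hs F θ hP hRg.1 hθ) (fun F θ hP hRg hθ => hκ F θ hP hRg.1 hθ) (fun F θ hP hRg hθ => hcr F θ hP hRg.1 hθ)
            (fun F θ hP hRg hθ => hρ F θ hP hRg.1 hθ) (h20_shape_crOneTerm₁₃ K₀) (h21_shape_crOneTerm₁₃ K₀)
            (fun F θ hP hRg hθ => (htarget F θ hP hRg hθ).mono fun g₀ hg os hPr =>
              (core_crOneTerm₁₃_iff_target K₀ θ hP g₀ os).2 (hg os hPr))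
            (fun _ θ hP _ _ => ForSmallCouplings.of_forall fun g₀ os => extraction_crOneTerm₁₃ K₀ θ hP g₀ os)
            (fun F θ hP hRg hθ => (hUK F θ hP hRg.1 hθ).1) (fun F θ hP hRg hθ => (hUK F θ hP hRg.1 hθ).2.1)
            (fun F θ hP hRg hθ => (hUK F θ hP hRg.1 hθ).2.2))
          F θ h.toCore hG hθ) _

end Summit.QuantumFields.YangMills.Theorems.BalabanUVNodesN27SpineRecord
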